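import Summits.ValiantsHypothesis.ValiantsHypothesis.Theorems.PolyaContinuedSignedCoverLittleSameBoard
import Mathlib.Data.Complex.Basic
import HarnessLib

/-!
# Route PolyaContinued — support item `SignedCoverLittle` (stmt-ValiantsHypothesis-7426):
# the same-board bicontraction of the target, II — the fold

Sequel to `…SignedCoverLittleSameBoard.lean` (`sbSubst`, `sbTarget`, the perfect matchings of the
target, the card drop (SB4)). Here, for row `a` of `E` equal to `{(a, b₀), (a, b₁)}` (`b₀ ≠ b₁`)
with no parallel row:

* `aeval_sbSubst_perfectMatchingPoly` — **(SB1)** `PM_E (x_e ↦ x_{sbSubst e}) = PM_{sbTarget}`: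
  the perfect matchings through `(a, b₁)` keep their monomial, those through `(a, b₀)` acquire
  the monomial of `swap b₀ b₁ * π`, and these are the perfect matchings of the target, each once;
* `labelIdentity_sbSubst` — **(SB2)** a label identity `Σ_{σ ⊆ H} Π_i X (φ (i, σ i)) = PM_E`
  composes to `Σ_{σ ⊆ H} Π_i X (sbSubst (φ (i, σ i))) = PM_{sbTarget}` — same source `H`, same
  board, no constants;
* `sbSignFwd`, `sbSignBwd`, `isPfaffianBipartite_sbTarget_iff` — **(SB3)** the target is Pfaffian
  iff `E` is (explicit transport of Pólya signings along `π ↦ π`, `π ↦ swap b₀ b₁ * π`; a moved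
  cell is twisted by `-s (a, b₀) * s (a, b₁)`);
* `exists_fold` — **the FOLD SPEC `hSB` of the driver `labelIdentity_chain_of`**
  (`…SignedCoverLittleChain.lean`): `∃ E₂ ψ, #E₂ < #E ∧ (E₂ Pfaffian ↔ E Pfaffian) ∧ every label
  identity onto E composes to one onto E₂ with ψ ∘ φ`.

(SB1) holds over any commutative ring of coefficients and any finite vertex type; (SB2) and
`exists_fold` are in the `ℂ`-valued, `Fin n`-indexed shape of the label identity.
-/

noncomputable section

namespace Summit.ValiantsHypothesis.PolyaContinued

open MvPolynomial Finset Literature.Combinatorics.SimpleGraph Equiv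

variable {V : Type*} [DecidableEq V]

/-! ### (SB1) The perfect-matching polynomial of the target is a substitution instance -/

section PM

variable [Fintype V]

/-- **(SB1) `PM_E (x_e ↦ x_{sbSubst e}) = PM_{sbTarget E}`.** The perfect matchings of `E` through
`(a, b₁)` keep their monomial, those through `(a, b₀)` acquire the monomial of `swap b₀ b₁ * π`
(reindex that half of the sum by `π ↦ swap b₀ b₁ * π`); by `forall_mem_sbTarget_iff` /
`not_both_of_noParallel` the two halves are exactly the perfect matchings of the target, each
once. [folklore] -/
theorem aeval_sbSubst_perfectMatchingPoly {E : Finset (V × V)} {a b₀ b₁ : V} (hb : b₀ ≠ b₁)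
    (hrow : ∀ c, (a, c) ∈ E ↔ c = b₀ ∨ c = b₁)
    (hNP : ∀ r, r ≠ a → ¬((r, b₀) ∈ E ∧ (r, b₁) ∈ E)) (k : Type*) [CommRing k] :
    aeval (fun e => (X (sbSubst a b₀ b₁ e) : MvPolynomial (V × V) k)) (perfectMatchingPoly E k) =
      perfectMatchingPoly (sbTarget E a b₀ b₁) k := by
  classical
  -- the substituted summand of `π`, split by `π a = b₁` / `π a = b₀`
  have hL : aeval (fun e => (X (sbSubst a b₀ b₁ e) : MvPolynomial (V × V) k))
      (perfectMatchingPoly E k) =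
      ∑ π : Perm V, ((if (∀ i, (i, π i) ∈ E) ∧ π a = b₁ then
          ∏ i, (X (i, π i) : MvPolynomial (V × V) k) else 0) +
        (if (∀ i, (i, π i) ∈ E) ∧ π a = b₀ then
          ∏ i, (X (i, (Equiv.swap b₀ b₁ * π) i) : MvPolynomial (V × V) k) else 0)) := by
    rw [perfectMatchingPoly_eq_sum_ite, map_sum]
    refine Finset.sum_congr rfl fun π _ => ?_
    by_cases hπ : ∀ i, (i, π i) ∈ E
    · rw [if_pos hπ, map_prod]
      rcases (hrow (π a)).1 (hπ a) with h0 | h1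
      · rw [if_neg fun h => hb (h0.symm.trans h.2), if_pos ⟨hπ, h0⟩, zero_add]
        refine Finset.prod_congr rfl fun i _ => ?_
        rw [aeval_X, sbSubst_apply_of_apply_eq_left hb π h0 i]
      · rw [if_pos ⟨hπ, h1⟩, if_neg fun h => hb (h.2.symm.trans h1), add_zero]
        refine Finset.prod_congr rfl fun i _ => ?_
        rw [aeval_X, sbSubst_apply_of_apply_eq_right π h1 i]
    · rw [if_neg hπ, map_zero, if_neg fun h => hπ h.1, if_neg fun h => hπ h.1, add_zero]
  -- reindex the second kind by `π ↦ swap b₀ b₁ * π`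
  let g : Perm V → MvPolynomial (V × V) k := fun ρ =>
    if (∀ i, (i, (Equiv.swap b₀ b₁ * ρ) i) ∈ E) ∧ ρ a = b₁ then ∏ i, X (i, ρ i) else 0
  have hg : ∀ π : Perm V, (if (∀ i, (i, π i) ∈ E) ∧ π a = b₀ then
        ∏ i, (X (i, (Equiv.swap b₀ b₁ * π) i) : MvPolynomial (V × V) k) else 0) =
      g (Equiv.swap b₀ b₁ * π) := by
    intro π
    have hss : Equiv.swap b₀ b₁ * (Equiv.swap b₀ b₁ * π) = π := by
      rw [← mul_assoc, Equiv.swap_mul_self, one_mul]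
    have hiff : π a = b₀ ↔ (Equiv.swap b₀ b₁ * π) a = b₁ := by
      rw [Perm.mul_apply]
      constructor
      · intro h
        rw [h, swap_apply_left]
      · intro h
        have h' := congrArg (Equiv.swap b₀ b₁) h
        rwa [swap_apply_self, swap_apply_right] at h'
    show _ = if (∀ i, (i, (Equiv.swap b₀ b₁ * (Equiv.swap b₀ b₁ * π)) i) ∈ E) ∧
        (Equiv.swap b₀ b₁ * π) a = b₁ then
      ∏ i, (X (i, (Equiv.swap b₀ b₁ * π) i) : MvPolynomial (V × V) k) else 0
    rw [hss]
    by_cases h : (∀ i, (i, π i) ∈ E) ∧ π a = b₀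
    · rw [if_pos h, if_pos ⟨h.1, hiff.1 h.2⟩]
    · rw [if_neg h, if_neg fun h' => h ⟨h'.1, hiff.2 h'.2⟩]
  have hreindex : (∑ π : Perm V, (if (∀ i, (i, π i) ∈ E) ∧ π a = b₀ then
        ∏ i, (X (i, (Equiv.swap b₀ b₁ * π) i) : MvPolynomial (V × V) k) else 0)) =
      ∑ ρ : Perm V, g ρ := by
    rw [Finset.sum_congr rfl fun π _ => hg π]
    exact Equiv.sum_comp (Equiv.mulLeft (Equiv.swap b₀ b₁)) g
  rw [hL, Finset.sum_add_distrib, hreindex, ← Finset.sum_add_distrib,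
    perfectMatchingPoly_eq_sum_ite]
  refine Finset.sum_congr rfl fun ρ _ => ?_
  show (if (∀ i, (i, ρ i) ∈ E) ∧ ρ a = b₁ then
        ∏ i, (X (i, ρ i) : MvPolynomial (V × V) k) else 0) +
      (if (∀ i, (i, (Equiv.swap b₀ b₁ * ρ) i) ∈ E) ∧ ρ a = b₁ then
        ∏ i, (X (i, ρ i) : MvPolynomial (V × V) k) else 0) =
      if (∀ i, (i, ρ i) ∈ sbTarget E a b₀ b₁) then
        ∏ i, (X (i, ρ i) : MvPolynomial (V × V) k) else 0
  -- compare with the target's summand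
  by_cases hρ : ∀ i, (i, ρ i) ∈ sbTarget E a b₀ b₁
  · rw [if_pos hρ]
    obtain ⟨hρa, hE | hE⟩ := (forall_mem_sbTarget_iff hb hrow ρ).1 hρ
    · rw [if_pos ⟨hE, hρa⟩, if_neg fun h => not_both_of_noParallel hb hNP hρa hE h.1, add_zero]
    · rw [if_neg fun h => not_both_of_noParallel hb hNP hρa h.1 hE, if_pos ⟨hE, hρa⟩, zero_add]
  · rw [if_neg hρ, if_neg fun h => hρ ((forall_mem_sbTarget_iff hb hrow ρ).2 ⟨h.2, Or.inl h.1⟩),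
      if_neg fun h => hρ ((forall_mem_sbTarget_iff hb hrow ρ).2 ⟨h.2, Or.inr h.1⟩), add_zero]

end PM

/-! ### (SB2) The label identity composes with the substitution -/

/-- **(SB2) Label identities survive the same-board bicontraction of the target.** If
`Σ_{σ ⊆ H} Π_i X (φ (i, σ i)) = PM_E` and row `a` of `E` is `{(a, b₀), (a, b₁)}` with no parallel
row, then `Σ_{σ ⊆ H} Π_i X (sbSubst a b₀ b₁ (φ (i, σ i))) = PM_{sbTarget E a b₀ b₁}` — the same
source `H`, the relabelling `sbSubst a b₀ b₁ ∘ φ`, the same board. [folklore] -/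
theorem labelIdentity_sbSubst {n : ℕ} {H E : Finset (Fin n × Fin n)}
    {φ : Fin n × Fin n → Fin n × Fin n} {a b₀ b₁ : Fin n} (hb : b₀ ≠ b₁)
    (hrow : ∀ c, (a, c) ∈ E ↔ c = b₀ ∨ c = b₁)
    (hNP : ∀ r, r ≠ a → ¬((r, b₀) ∈ E ∧ (r, b₁) ∈ E))
    (hid : (∑ σ : Perm (Fin n), if (∀ i, (i, σ i) ∈ H) then
        ∏ i, (X (φ (i, σ i)) : MvPolynomial (Fin n × Fin n) ℂ) else 0) =
      perfectMatchingPoly E ℂ) :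
    (∑ σ : Perm (Fin n), if (∀ i, (i, σ i) ∈ H) then
        ∏ i, (X (sbSubst a b₀ b₁ (φ (i, σ i))) : MvPolynomial (Fin n × Fin n) ℂ) else 0) =
      perfectMatchingPoly (sbTarget E a b₀ b₁) ℂ := by
  have h := congrArg (aeval fun e => (X (sbSubst a b₀ b₁ e) : MvPolynomial (Fin n × Fin n) ℂ))
    hid
  rw [aeval_sbSubst_perfectMatchingPoly hb hrow hNP ℂ, map_sum] at h
  rw [← h]
  refine Finset.sum_congr rfl fun σ _ => ?_
  split_ifs
  · rw [map_prod]
    refine Finset.prod_congr rfl fun i _ => ?_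
    rw [aeval_X]
  · rw [map_zero]

/-! ### (SB3) The target is Pfaffian iff `E` is -/

/-- The forward signing transport: a moved cell `(r, b₀)` (image of `(r, b₁)`, `r ≠ a`) gets
`-(s (a, b₀) * s (a, b₁) * s (r, b₁))`, every other cell keeps `s`. [folklore] -/
def sbSignFwd (E : Finset (V × V)) (a b₀ b₁ : V) (s : V × V → ℤˣ) (e : V × V) : ℤˣ :=
  if e.2 = b₀ ∧ e.1 ≠ a ∧ (e.1, b₁) ∈ E then -(s (a, b₀) * s (a, b₁) * s (e.1, b₁)) else s e

/-- Value of the forward transport on a moved cell. [folklore] -/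
theorem sbSignFwd_moved (E : Finset (V × V)) (a b₀ b₁ : V) (s : V × V → ℤˣ) {r : V}
    (hr : r ≠ a) (hE : (r, b₁) ∈ E) :
    sbSignFwd E a b₀ b₁ s (r, b₀) = -(s (a, b₀) * s (a, b₁) * s (r, b₁)) := by
  unfold sbSignFwd
  rw [if_pos ⟨rfl, hr, hE⟩]

/-- Value of the forward transport on a cell that is not moved. [folklore] -/
theorem sbSignFwd_of_not (E : Finset (V × V)) (a b₀ b₁ : V) (s : V × V → ℤˣ) {e : V × V}
    (h : ¬(e.2 = b₀ ∧ e.1 ≠ a ∧ (e.1, b₁) ∈ E)) : sbSignFwd E a b₀ b₁ s e = s e := by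
  unfold sbSignFwd
  rw [if_neg h]

/-- The backward signing transport: `(a, b₀)` gets `-s' (a, b₁)`, a cell `(r, b₁)` (`r ≠ a`) gets
the sign `s' (r, b₀)` of its image, every other cell keeps `s'`. [folklore] -/
def sbSignBwd (a b₀ b₁ : V) (s' : V × V → ℤˣ) (e : V × V) : ℤˣ :=
  if e = (a, b₀) then -s' (a, b₁) else if e.2 = b₁ ∧ e.1 ≠ a then s' (e.1, b₀) else s' e

/-- Value of the backward transport at `(a, b₀)`. [folklore] -/
theorem sbSignBwd_left (a b₀ b₁ : V) (s' : V × V → ℤˣ) :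
    sbSignBwd a b₀ b₁ s' (a, b₀) = -s' (a, b₁) := by
  unfold sbSignBwd
  rw [if_pos rfl]

/-- Value of the backward transport on a cell of column `b₁` off row `a`. [folklore] -/
theorem sbSignBwd_col (a : V) {b₀ b₁ : V} (s' : V × V → ℤˣ) {r : V} (hr : r ≠ a) :
    sbSignBwd a b₀ b₁ s' (r, b₁) = s' (r, b₀) := by
  unfold sbSignBwd
  rw [if_neg (fun h => hr (Prod.mk_inj.1 h).1), if_pos ⟨rfl, hr⟩]

/-- Value of the backward transport on any other cell. [folklore] -/
theorem sbSignBwd_of_ne (a b₀ b₁ : V) (s' : V × V → ℤˣ) {e : V × V} (h0 : e ≠ (a, b₀))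
    (h1 : ¬(e.2 = b₁ ∧ e.1 ≠ a)) : sbSignBwd a b₀ b₁ s' e = s' e := by
  unfold sbSignBwd
  rw [if_neg h0, if_neg h1]

section Pfaffian

variable [Fintype V]

/-- In `ℤˣ`: `y * -(x * y * z) = -(x * z)`. [folklore] -/
theorem units_mul_neg_mul_mul_mul (x y z : ℤˣ) : y * -(x * y * z) = -(x * z) := by
  rw [mul_neg, mul_comm x y, mul_assoc, ← mul_assoc, Int.units_mul_self, one_mul]

/-- Products over `V` of two `ℤˣ`-valued functions that agree outside two points `a ≠ r` where
their partial products are opposite: `∏ f = -∏ g`. [folklore] -/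
theorem prod_eq_neg_prod_of_pair {f g : V → ℤˣ} {a r : V} (har : a ≠ r)
    (h2 : f a * f r = -(g a * g r)) (h : ∀ i, i ≠ a → i ≠ r → f i = g i) :
    ∏ i, f i = -∏ i, g i := by
  have hr : r ∈ Finset.univ.erase a := Finset.mem_erase.2 ⟨har.symm, Finset.mem_univ _⟩
  rw [← Finset.mul_prod_erase Finset.univ f (Finset.mem_univ a), ← Finset.mul_prod_erase _ f hr,
    ← Finset.mul_prod_erase Finset.univ g (Finset.mem_univ a), ← Finset.mul_prod_erase _ g hr,
    ← mul_assoc, ← mul_assoc, h2,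
    Finset.prod_congr rfl fun i hi => h i (Finset.ne_of_mem_erase (Finset.mem_of_mem_erase hi))
      (Finset.ne_of_mem_erase hi), neg_mul]

/-- **(SB3, →)** a Pólya signing `s` of `E` induces one of the target (`sbSignFwd`).
[folklore] -/
theorem isPfaffianBipartite_sbTarget {E : Finset (V × V)} {a b₀ b₁ : V} (hb : b₀ ≠ b₁)
    (hrow : ∀ c, (a, c) ∈ E ↔ c = b₀ ∨ c = b₁)
    (hNP : ∀ r, r ≠ a → ¬((r, b₀) ∈ E ∧ (r, b₁) ∈ E)) (hE : IsPfaffianBipartite E) :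
    IsPfaffianBipartite (sbTarget E a b₀ b₁) := by
  classical
  obtain ⟨s, hs⟩ := hE
  refine ⟨sbSignFwd E a b₀ b₁ s, fun ρ hρ => ?_⟩
  obtain ⟨hρa, hE | hE⟩ := (forall_mem_sbTarget_iff hb hrow ρ).1 hρ
  · -- `ρ` itself is a perfect matching of `E`: the signs agree cell by cell
    have hcell : ∀ i, sbSignFwd E a b₀ b₁ s (i, ρ i) = s (i, ρ i) := by
      intro i
      refine sbSignFwd_of_not E a b₀ b₁ s ?_
      rintro ⟨h0, hia, hE1⟩
      refine hNP i hia ⟨?_, hE1⟩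
      have := hE i
      rwa [show ρ i = b₀ from h0] at this
    rw [Finset.prod_congr rfl fun i _ => hcell i]
    exact hs ρ hE
  · -- `π = swap b₀ b₁ * ρ` is a perfect matching of `E`
    set π := Equiv.swap b₀ b₁ * ρ with hπ
    obtain ⟨r₀, hρr₀⟩ : ∃ r₀, ρ r₀ = b₀ := ⟨ρ.symm b₀, ρ.apply_symm_apply b₀⟩
    have hr₀a : r₀ ≠ a := by
      intro e
      rw [e, hρa] at hρr₀
      exact hb hρr₀.symm
    have hπa : π a = b₀ := by rw [hπ, Perm.mul_apply, hρa, swap_apply_right]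
    have hπr₀ : π r₀ = b₁ := by rw [hπ, Perm.mul_apply, hρr₀, swap_apply_left]
    have hr₀E : (r₀, b₁) ∈ E := by
      have := hE r₀
      rwa [hπr₀] at this
    have hsign : Perm.sign ρ = -Perm.sign π := by
      rw [hπ, Perm.sign_mul, Perm.sign_swap hb, neg_one_mul, neg_neg]
    have hprod : ∏ i, sbSignFwd E a b₀ b₁ s (i, ρ i) = -∏ i, s (i, π i) := by
      refine prod_eq_neg_prod_of_pair hr₀a.symm ?_ fun i hia hir => ?_
      · rw [hρa, hρr₀, hπa, hπr₀, sbSignFwd_moved E a b₀ b₁ s hr₀a hr₀E,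
          sbSignFwd_of_not E a b₀ b₁ s (fun h => hb.symm h.1)]
        exact units_mul_neg_mul_mul_mul _ _ _
      · have h0 : ρ i ≠ b₀ := fun e => hir (ρ.injective (e.trans hρr₀.symm))
        have h1 : ρ i ≠ b₁ := fun e => hia (ρ.injective (e.trans hρa.symm))
        have hπi : π i = ρ i := by rw [hπ, Perm.mul_apply, swap_apply_of_ne_of_ne h0 h1]
        rw [sbSignFwd_of_not E a b₀ b₁ s (fun h => h0 h.1), hπi]
    rw [hsign, hprod, neg_mul_neg]
    exact hs π hE

/-- **(SB3, ←)** a Pólya signing `s'` of the target induces one of `E` (`sbSignBwd`).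
[folklore] -/
theorem isPfaffianBipartite_of_sbTarget {E : Finset (V × V)} {a b₀ b₁ : V} (hb : b₀ ≠ b₁)
    (hrow : ∀ c, (a, c) ∈ E ↔ c = b₀ ∨ c = b₁)
    (hE' : IsPfaffianBipartite (sbTarget E a b₀ b₁)) : IsPfaffianBipartite E := by
  classical
  obtain ⟨s', hs'⟩ := hE'
  refine ⟨sbSignBwd a b₀ b₁ s', fun π hπ => ?_⟩
  rcases (hrow (π a)).1 (hπ a) with hπa | hπa
  · -- `π a = b₀`: `ρ = swap b₀ b₁ * π` is a perfect matching of the target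
    set ρ := Equiv.swap b₀ b₁ * π with hρ
    have hρmem : ∀ i, (i, ρ i) ∈ sbTarget E a b₀ b₁ :=
      forall_mem_sbTarget_of_apply_eq_left hb hπ hπa
    obtain ⟨r₀, hπr₀⟩ : ∃ r₀, π r₀ = b₁ := ⟨π.symm b₁, π.apply_symm_apply b₁⟩
    have hr₀a : r₀ ≠ a := by
      intro e
      rw [e, hπa] at hπr₀
      exact hb hπr₀
    have hρa : ρ a = b₁ := by rw [hρ, Perm.mul_apply, hπa, swap_apply_left]
    have hρr₀ : ρ r₀ = b₀ := by rw [hρ, Perm.mul_apply, hπr₀, swap_apply_right]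
    have hsign : Perm.sign π = -Perm.sign ρ := by
      rw [hρ, Perm.sign_mul, Perm.sign_swap hb, neg_one_mul, neg_neg]
    have hprod : ∏ i, sbSignBwd a b₀ b₁ s' (i, π i) = -∏ i, s' (i, ρ i) := by
      refine prod_eq_neg_prod_of_pair hr₀a.symm ?_ fun i hia hir => ?_
      · rw [hπa, hπr₀, hρa, hρr₀, sbSignBwd_left, sbSignBwd_col a s' hr₀a, neg_mul]
      · have h0 : π i ≠ b₀ := fun e => hia (π.injective (e.trans hπa.symm))
        have h1 : π i ≠ b₁ := fun e => hir (π.injective (e.trans hπr₀.symm))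
        have hρi : ρ i = π i := by rw [hρ, Perm.mul_apply, swap_apply_of_ne_of_ne h0 h1]
        rw [sbSignBwd_of_ne a b₀ b₁ s' (fun h => hia (Prod.mk_inj.1 h).1) (fun h => h1 h.1), hρi]
    rw [hsign, hprod, neg_mul_neg]
    exact hs' ρ hρmem
  · -- `π a = b₁`: `π` is a perfect matching of the target, the signs agree cell by cell
    have hcell : ∀ i, sbSignBwd a b₀ b₁ s' (i, π i) = s' (i, π i) := by
      intro i
      by_cases hia : i = a
      · subst hia
        rw [hπa]
        exact sbSignBwd_of_ne i b₀ b₁ s' (fun h => hb (Prod.mk_inj.1 h).2.symm) (fun h => h.2 rfl)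
      · refine sbSignBwd_of_ne a b₀ b₁ s' (fun h => hia (Prod.mk_inj.1 h).1) ?_
        rintro ⟨h, -⟩
        exact hia (π.injective ((show π i = b₁ from h).trans hπa.symm))
    rw [Finset.prod_congr rfl fun i _ => hcell i]
    exact hs' π (forall_mem_sbTarget_of_apply_eq_right hπ hπa)

/-- **(SB3) The same-board bicontraction of the target is Pfaffian iff the target is.**
[folklore] -/
theorem isPfaffianBipartite_sbTarget_iff {E : Finset (V × V)} {a b₀ b₁ : V} (hb : b₀ ≠ b₁)
    (hrow : ∀ c, (a, c) ∈ E ↔ c = b₀ ∨ c = b₁)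
    (hNP : ∀ r, r ≠ a → ¬((r, b₀) ∈ E ∧ (r, b₁) ∈ E)) :
    IsPfaffianBipartite (sbTarget E a b₀ b₁) ↔ IsPfaffianBipartite E :=
  ⟨isPfaffianBipartite_of_sbTarget hb hrow, isPfaffianBipartite_sbTarget hb hrow hNP⟩

end Pfaffian

/-! ### The fold spec of the driver -/

/-- **The FOLD** (spec `hSB` of `labelIdentity_chain_of`, `…SignedCoverLittleChain.lean`): if row
`a` of `E ⊆ Fin n × Fin n` consists of exactly the cells `(a, b₀)`, `(a, b₁)` (`b₀ ≠ b₁`) and no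
other row sees both columns, then there are a target `E₂` on the same board with fewer cells,
Pfaffian iff `E` is, and a cell relabelling `ψ` such that every label identity onto `E` (from any
source `H`, any `φ`) composes to a label identity onto `E₂` with `ψ ∘ φ`. Witnesses:
`E₂ = sbTarget E a b₀ b₁`, `ψ = sbSubst a b₀ b₁`. [folklore] -/
theorem exists_fold {n : ℕ} (E : Finset (Fin n × Fin n)) (a b₀ b₁ : Fin n) (hb : b₀ ≠ b₁)
    (hrow : ∀ c, (a, c) ∈ E ↔ c = b₀ ∨ c = b₁)
    (hNP : ∀ r, r ≠ a → ¬((r, b₀) ∈ E ∧ (r, b₁) ∈ E)) :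
    ∃ (E₂ : Finset (Fin n × Fin n)) (ψ : Fin n × Fin n → Fin n × Fin n),
      E₂.card < E.card ∧ (IsPfaffianBipartite E₂ ↔ IsPfaffianBipartite E) ∧
      ∀ (H : Finset (Fin n × Fin n)) (φ : Fin n × Fin n → Fin n × Fin n),
        (∑ σ : Perm (Fin n), if (∀ i, (i, σ i) ∈ H) then
            ∏ i, (X (φ (i, σ i)) : MvPolynomial (Fin n × Fin n) ℂ) else 0) =
          perfectMatchingPoly E ℂ →
        (∑ σ : Perm (Fin n), if (∀ i, (i, σ i) ∈ H) then
            ∏ i, (X ((ψ ∘ φ) (i, σ i)) : MvPolynomial (Fin n × Fin n) ℂ) else 0) =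
          perfectMatchingPoly E₂ ℂ := by
  refine ⟨sbTarget E a b₀ b₁, sbSubst a b₀ b₁, ?_, isPfaffianBipartite_sbTarget_iff hb hrow hNP,
    fun H φ hid => ?_⟩
  · have h := card_sbTarget_add_one hb hrow hNP
    omega
  · exact labelIdentity_sbSubst hb hrow hNP hid

/-- `exists_fold` with the composed relabelling written APPLIED, `X (ψ (φ (i, σ i)))` — the literal
shape of the hypothesis `hSB` of the driver `labelIdentity_chain_of` (`…SignedCoverLittleChain.lean`),
so that `hSB := exists_fold'` is a syntactic match. [folklore] -/
theorem exists_fold' {n : ℕ} (E : Finset (Fin n × Fin n)) (a b₀ b₁ : Fin n) (hb : b₀ ≠ b₁)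
    (hrow : ∀ c, (a, c) ∈ E ↔ c = b₀ ∨ c = b₁)
    (hNP : ∀ r, r ≠ a → ¬((r, b₀) ∈ E ∧ (r, b₁) ∈ E)) :
    ∃ (E₂ : Finset (Fin n × Fin n)) (ψ : Fin n × Fin n → Fin n × Fin n),
      E₂.card < E.card ∧ (IsPfaffianBipartite E₂ ↔ IsPfaffianBipartite E) ∧
      ∀ (H : Finset (Fin n × Fin n)) (φ : Fin n × Fin n → Fin n × Fin n),
        (∑ σ : Perm (Fin n), if (∀ i, (i, σ i) ∈ H) then
            ∏ i, (X (φ (i, σ i)) : MvPolynomial (Fin n × Fin n) ℂ) else 0) =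
          perfectMatchingPoly E ℂ →
        (∑ σ : Perm (Fin n), if (∀ i, (i, σ i) ∈ H) then
            ∏ i, (X (ψ (φ (i, σ i))) : MvPolynomial (Fin n × Fin n) ℂ) else 0) =
          perfectMatchingPoly E₂ ℂ := by
  obtain ⟨E₂, ψ, hcard, hiff, hlab⟩ := exists_fold E a b₀ b₁ hb hrow hNP
  exact ⟨E₂, ψ, hcard, hiff, fun H φ hid => by simpa only [Function.comp_apply] using hlab H φ hid⟩

end Summit.ValiantsHypothesis.PolyaContinued
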